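import Mathlib
import HarnessLib
import Summits.NavierStokesRegularity.NavierStokesRegularity.Theorems.HalfSpaceWindowDoorCirculationCarryingRigidityEddyTorqueEnergyClass
import Summits.NavierStokesRegularity.NavierStokesRegularity.Theorems.AxisTwistDoorAveragedConeLiouvilleHolds

/-!
# Route `HalfSpaceWindowDoor`, crux `CirculationCarryingRigidity` (stmt-NavierStokesRegularity-25311) — ENERGY-CLASS FLUX DECAY
# under the one-sided EDDY hypothesis (AxisTwistDoor's proved `AveragedConeLiouville` pipeline re-run without the cone)

Line `eddy_torque` (LEAD ns-hsw-p1 g4).  The sibling route AxisTwistDoor proved (crux 26889) that an energy-class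
closed-hemisphere profile obeying the circle-averaged cone `∮|ω_h| dl ≤ K ∮ω₃ dl` has flux decay at the apex and is regular
there.  The cone enters that proof twice: in the PDE step (Lei–Ren–Tian eq. Gamma-34) and in the ε-regularity endgame.  This
file re-runs the FIRST use with the cone replaced by the weaker, dynamic EDDY HYPOTHESIS of this line, keeping every other brick
of AxisTwistDoor's (proved, unconditional) pipeline:

  (i) the MEAN radial tilt is dominated by the mean vertical vorticity, `|∮_{S(r,z)} ω_r dl| ≤ K ∮_{S(r,z)} ω₃ dl`;
  (ii) the ONE-SIDED eddy torque (fluctuation remainder `ℛ` of the circle-averaged swirl law, AxisTwistDoor `…Defs.remainder`)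
       is slaved to the vertical-vorticity flux at the local velocity scale: `ℛ(r,z,s) ≤ K'·B·∮ω₃ dl` whenever `|v(s)| ≤ B` on
       `S(r,z)` (eddies may spin the mean vortex DOWN freely).

* `gamma34_of_eddy` — (i)+(ii) on a circle with `|v| ≤ B` give eq. Gamma-34 `∂ₛΓ − Γ_zz − Γ_rr + (r⁻¹ − B(1+K+K'))∂ᵣΓ ≤ 0`
  (from the circle-averaged swirl identity; the mean advection `v̄_rΓ_r + v̄_zΓ_z` is absorbed because `|v̄| ≤ B` and
  `|Γ_z| = |∮ω_r| ≤ KΓ_r`);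
* `axisCirculationData_of_eddy`, `unitContraction_of_eddy` — AxisTwistDoor's stub (5a) `stub_shellSupersolution` and brick F4
  `unitContraction_of`, re-run verbatim with the cone hypothesis replaced;
* `eddyHyp_nsRescale` (with `radVortCirc/meanR/meanZ/remainder_nsRescale`) — the hypothesis is scale invariant;
* **`fluxDecay_of_eddy`** (UNCONDITIONAL): `InClass C v π H → SignE3 v →` (i)+(ii) for all `r>0, z, s<0` `→ FluxDecay v`, from
  `Shell.shellFact_holds`, `PositivityFactC.positivityPropagationFactC_holds`, `HarnackChain.axisHarnackChain`,
  `fluxDecay_of_scale_contraction` (all AxisTwistDoor, proved);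
* `eddyHyp_of_cone`, `fluxDecay_of_cone` — the cone implies (i)+(ii) with `K' = 2(1+K)`, so the flux-decay half of 26889 is a
  corollary.

CENSUS MEANING.  In the door's OWN energy class, the PDE half of the residue is dynamic: flux decay at the apex holds as soon
as eddies do not spin axis circles UP faster than the mean vertical vorticity allows (plus mean-tilt control); what the cone is
still needed for is only the endgame «flux decay ⇒ regular apex» (`RegularOfFluxDecay`, control of `ω_h`), a poloidal-type
statement.  So AxisTwistDoor's last open crux 26991 (`TiltDominationLoc`) splits into «singular ⇒ eddy spin-up control near the
apex» and «flux decay + closed hemisphere ⇒ regular» (memo EDDY-TORQUE-g4.md v3; planner's call).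

Seat ns-hsw-p1 g4 (LEAD of 25311, cell pub-ns-dss).  WHAT THIS IS NOT: not a statement about Navier–Stokes regularity
(Clay A): flux decay for HYPOTHETICAL Type-I blow-up profiles of the energy class; not regularity of the apex, not the crux,
nothing of AxisTwistDoor re-registered; helper `--supports` 25311.
-/

noncomputable section

-- the summit and its single sub-problem share the name (CONVENTIONS §1), as in every Theorems file
set_option linter.dupNamespace false

namespace Summit.NavierStokesRegularity.NavierStokesRegularity.Theorems.HalfSpaceWindowDoorCirculationCarryingRigidityEddyTorqueFluxDecay

open MeasureTheory Set Function Filter Topology TopologicalSpace InnerProductSpace Metric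
open scoped RealInnerProductSpace ENNReal
open Literature.Analysis
open Literature.Analysis.FluidPDE hiding eR
open Summit.NavierStokesRegularity.NavierStokesRegularity.Theorems
open Summit.NavierStokesRegularity.NavierStokesRegularity.Theorems.AxisTwistDoorAveragedConeLiouvilleDefs
open Summit.NavierStokesRegularity.NavierStokesRegularity.Theorems.AxisTwistDoorAveragedConeLiouvilleCircleToolkit (contDiff_slice)
open Summit.NavierStokesRegularity.NavierStokesRegularity.Theorems.AxisTwistDoorAveragedConeLiouvilleRescale
open Summit.NavierStokesRegularity.NavierStokesRegularity.Theorems.AxisTwistDoorScalingToUnit (curl_nsRescale_apply)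
open Summit.NavierStokesRegularity.NavierStokesRegularity.Theorems.AxisTwistDoorAveragedConeLiouvilleFluxIteration
open Summit.NavierStokesRegularity.NavierStokesRegularity.Theorems.AxisTwistDoorAveragedConeLiouvilleUnitContraction
  (AxisCirculationData AxisHarnackChain)
open Summit.NavierStokesRegularity.NavierStokesRegularity.Theorems.AveragedConeLiouville.CircMonotone (circ_mono circ_nonneg vortCirc_nonneg)
open Summit.NavierStokesRegularity.NavierStokesRegularity.Theorems.AveragedConeLiouville.CircleCalculus (deriv_circ_z)
open Summit.NavierStokesRegularity.NavierStokesRegularity.Theorems.AveragedConeLiouville.ShellBound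
  (circ_le_of_shellFact circ_le_typeI norm_le_on_shell_or_early)
open Summit.NavierStokesRegularity.NavierStokesRegularity.Theorems.AxisTwistDoorAveragedConeLiouvilleCylFrame
  (abs_inner_eR_le_norm_horizontal continuous_cylPt_θ)
open Summit.NavierStokesRegularity.NavierStokesRegularity.Theorems.AveragedConeLiouville.CircleStokes (continuous_eR)
open Summit.NavierStokesRegularity.NavierStokesRegularity.Theorems.HalfSpaceWindowDoorCirculationCarryingRigidityEddyTorqueStrata
  (abs_meanR_le abs_meanZ_le)
open Summit.NavierStokesRegularity.NavierStokesRegularity.Theorems.HalfSpaceWindowDoorCirculationCarryingRigidityEddyTorqueEnergyClass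
  (remainder_le_of_cone_on_circle)

variable {C : ℝ} {v : ℝ → EuclideanSpace ℝ (Fin 3) → EuclideanSpace ℝ (Fin 3)}
  {π : ℝ → EuclideanSpace ℝ (Fin 3) → ℝ}
  {H : ℝ → EuclideanSpace ℝ (Fin 3) → EuclideanSpace ℝ (Fin 3) →L[ℝ] EuclideanSpace ℝ (Fin 3)}

/-! ### Scale covariance of the remaining circle functionals -/

/-- `∮ω_r dl` picks up one factor `δ`: `radVortCirc (v^{(δ)}) r z s = δ · radVortCirc v (δr) (δz) (δ²s)`. -/
theorem radVortCirc_nsRescale (v : ℝ → EuclideanSpace ℝ (Fin 3) → EuclideanSpace ℝ (Fin 3)) (δ r z s : ℝ) :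
    radVortCirc (nsRescale δ v) r z s = δ * radVortCirc v (δ * r) (δ * z) (δ ^ 2 * s) := by
  unfold radVortCirc
  rw [← intervalIntegral.integral_const_mul]
  congr 1
  funext θ
  rw [curl_nsRescale_apply, smul_cylPt, real_inner_smul_left]
  ring

/-- The circle mean `v̄_r` picks up one factor `δ`. -/
theorem meanR_nsRescale (v : ℝ → EuclideanSpace ℝ (Fin 3) → EuclideanSpace ℝ (Fin 3)) (δ r z s : ℝ) :
    meanR (nsRescale δ v) r z s = δ * meanR v (δ * r) (δ * z) (δ ^ 2 * s) := by
  unfold meanR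
  rw [mul_left_comm]
  congr 1
  rw [← intervalIntegral.integral_const_mul]
  congr 1
  funext θ
  rw [nsRescale_apply, smul_cylPt, real_inner_smul_left]

/-- The circle mean `v̄_z` picks up one factor `δ`. -/
theorem meanZ_nsRescale (v : ℝ → EuclideanSpace ℝ (Fin 3) → EuclideanSpace ℝ (Fin 3)) (δ r z s : ℝ) :
    meanZ (nsRescale δ v) r z s = δ * meanZ v (δ * r) (δ * z) (δ ^ 2 * s) := by
  unfold meanZ
  rw [mul_left_comm]
  congr 1
  rw [← intervalIntegral.integral_const_mul]
  congr 1
  funext θ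
  rw [nsRescale_apply, smul_cylPt, real_inner_smul_left]

/-- The fluctuation remainder picks up two factors `δ`: `ℛ(v^{(δ)})(r,z,s) = δ² · ℛ(v)(δr, δz, δ²s)`. -/
theorem remainder_nsRescale (v : ℝ → EuclideanSpace ℝ (Fin 3) → EuclideanSpace ℝ (Fin 3)) (δ r z s : ℝ) :
    remainder (nsRescale δ v) r z s = δ ^ 2 * remainder v (δ * r) (δ * z) (δ ^ 2 * s) := by
  unfold remainder
  rw [← intervalIntegral.integral_const_mul]
  congr 1
  funext θ
  rw [meanR_nsRescale, meanZ_nsRescale, nsRescale_apply, curl_nsRescale_apply, smul_cylPt, real_inner_smul_left,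
    real_inner_smul_left, real_inner_smul_left, real_inner_smul_left]
  ring

/-- **The EDDY HYPOTHESIS is scale invariant.**  The hypothesis of this file — mean radial tilt dominated by the mean vertical
vorticity, `|∮ω_r dl| ≤ K ∮ω₃ dl`, and one-sided eddy torque slaved to the vertical-vorticity flux relative to the velocity
scale on the circle, `ℛ ≤ K'·B·∮ω₃ dl` whenever `|v| ≤ B` on `S(r,z)` — holds for `v^{(δ)}` if it holds for `v`. -/
theorem eddyHyp_nsRescale {K K' : ℝ}
    (h : ∀ s : ℝ, s < 0 → ∀ r : ℝ, 0 < r → ∀ z : ℝ,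
      |radVortCirc v r z s| ≤ K * vortCirc v r z s ∧
        ∀ B : ℝ, (∀ θ : ℝ, ‖v s (cylPt r θ z)‖ ≤ B) → remainder v r z s ≤ K' * B * vortCirc v r z s)
    {δ : ℝ} (hδ : 0 < δ) :
    ∀ s : ℝ, s < 0 → ∀ r : ℝ, 0 < r → ∀ z : ℝ,
      |radVortCirc (nsRescale δ v) r z s| ≤ K * vortCirc (nsRescale δ v) r z s ∧
        ∀ B : ℝ, (∀ θ : ℝ, ‖nsRescale δ v s (cylPt r θ z)‖ ≤ B) →
          remainder (nsRescale δ v) r z s ≤ K' * B * vortCirc (nsRescale δ v) r z s := by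
  intro s hs r hr z
  obtain ⟨h1, h2⟩ := h (δ ^ 2 * s) (mul_neg_of_pos_of_neg (by positivity) hs) (δ * r) (mul_pos hδ hr) (δ * z)
  refine ⟨?_, fun B hB => ?_⟩
  · rw [radVortCirc_nsRescale, vortCirc_nsRescale, abs_mul, abs_of_pos hδ]
    nlinarith
  · -- `|v| ≤ B/δ` on the original circle
    have hB' : ∀ θ : ℝ, ‖v (δ ^ 2 * s) (cylPt (δ * r) θ (δ * z))‖ ≤ B / δ := by
      intro θ
      have h := hB θ
      rw [nsRescale_apply, smul_cylPt, norm_smul, Real.norm_of_nonneg hδ.le] at h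
      rw [le_div_iff₀ hδ]; linarith
    have h3 := h2 (B / δ) hB'
    rw [remainder_nsRescale, vortCirc_nsRescale]
    have : δ ^ 2 * remainder v (δ * r) (δ * z) (δ ^ 2 * s) ≤ δ ^ 2 * (K' * (B / δ) * vortCirc v (δ * r) (δ * z) (δ ^ 2 * s)) :=
      mul_le_mul_of_nonneg_left h3 (by positivity)
    calc δ ^ 2 * remainder v (δ * r) (δ * z) (δ ^ 2 * s)
        ≤ δ ^ 2 * (K' * (B / δ) * vortCirc v (δ * r) (δ * z) (δ ^ 2 * s)) := this
      _ = K' * B * (δ * vortCirc v (δ * r) (δ * z) (δ ^ 2 * s)) := by field_simp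

/-- **The cone implies the eddy hypothesis** (energy class): `∮|ω_h| ≤ K∮ω₃` gives `|∮ω_r| ≤ K∮ω₃` and `ℛ ≤ 2(1+K)·B·∮ω₃` on
circles with `|v| ≤ B` — so every result below contains its cone version. -/
theorem eddyHyp_of_cone (h : InClass C v π H) (hsign : SignE3 v) {K : ℝ}
    (hK : ∀ s : ℝ, s < 0 → ∀ r : ℝ, 0 < r → ∀ z : ℝ, tiltCirc v r z s ≤ K * vortCirc v r z s) :
    ∀ s : ℝ, s < 0 → ∀ r : ℝ, 0 < r → ∀ z : ℝ,
      |radVortCirc v r z s| ≤ K * vortCirc v r z s ∧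
        ∀ B : ℝ, (∀ θ : ℝ, ‖v s (cylPt r θ z)‖ ≤ B) → remainder v r z s ≤ 2 * (1 + K) * B * vortCirc v r z s := by
  intro s hs r hr z
  refine ⟨?_, fun B hB => ?_⟩
  · -- `|∮ω_r dl| ≤ ∮|ω_h| dl ≤ K∮ω₃`
    have hv1 : ContDiff ℝ 1 (v s) := (contDiff_slice h hs).of_le (by norm_cast)
    have hωc : Continuous fun θ => curl (v s) (cylPt r θ z) := (continuous_curl hv1).comp (continuous_cylPt_θ r z)
    have hle : |radVortCirc v r z s| ≤ tiltCirc v r z s := by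
      unfold radVortCirc tiltCirc
      have h2π : (0 : ℝ) ≤ 2 * Real.pi := by positivity
      refine (intervalIntegral.abs_integral_le_integral_abs h2π).trans ?_
      refine intervalIntegral.integral_mono_on h2π (((hωc.inner continuous_eR).mul continuous_const).abs.intervalIntegrable _ _)
        ((( (AxisTwistDoorAveragedConeLiouvilleCylFrame.continuous_horizontal.comp hωc).norm).mul
          continuous_const).intervalIntegrable _ _) fun θ _ => ?_
      rw [abs_mul, abs_of_nonneg hr.le]
      exact mul_le_mul_of_nonneg_right (abs_inner_eR_le_norm_horizontal _ θ) hr.le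
    exact hle.trans (hK s hs r hr z)
  · have h := remainder_le_of_cone_on_circle h hsign hs hr (hK s hs r hr z) hB
    calc remainder v r z s ≤ 2 * B * (1 + K) * vortCirc v r z s := h
      _ = 2 * (1 + K) * B * vortCirc v r z s := by ring

/-! ### Eq. Gamma-34 under the eddy hypothesis, and the axis-circulation data (stub (5a) of AxisTwistDoor re-run) -/

/-- **Eq. Gamma-34 under the eddy hypothesis** on a circle where `|v| ≤ B`: `∂ₛΓ − Γ_zz − Γ_rr + (r⁻¹ − B(1+K+K'))∂ᵣΓ ≤ 0`
(from the circle-averaged swirl identity: `∂ₛΓ = Γ_rr − r⁻¹Γ_r + Γ_zz + ℛ − v̄_rΓ_r − v̄_zΓ_z` with `|v̄_r|, |v̄_z| ≤ B`,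
`|Γ_z| = |∮ω_r| ≤ K Γ_r`, `ℛ ≤ K' B Γ_r`, `Γ_r = ∮ω₃ ≥ 0`). -/
theorem gamma34_of_eddy (h : InClass C v π H) (hsign : SignE3 v) (hcse : CircleSwirlEquation v) {s r z K K' B : ℝ}
    (hs : s < 0) (hr : 0 < r)
    (hrad : |radVortCirc v r z s| ≤ K * vortCirc v r z s) (heddy : remainder v r z s ≤ K' * B * vortCirc v r z s)
    (hB : ∀ θ : ℝ, ‖v s (cylPt r θ z)‖ ≤ B) :
    deriv (fun s' => circ v r z s') s
      - deriv (fun z' => deriv (fun z'' => circ v r z'' s) z') z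
      - deriv (fun r' => deriv (fun r'' => circ v r'' z s) r') r
      + (r⁻¹ - B * (1 + K + K')) * deriv (fun r' => circ v r' z s) r ≤ 0 := by
  obtain ⟨h1, h2⟩ := hcse s hs r hr z
  have hv1 : ContDiff ℝ 1 (v s) := (contDiff_slice h hs).of_le (by norm_cast)
  have hz : deriv (fun z' => circ v r z' s) z = -radVortCirc v r z s := deriv_circ_z v hv1 r z
  have hW : 0 ≤ vortCirc v r z s := vortCirc_nonneg v hsign hs hr.le z
  have hmR := abs_meanR_le (v := v) (s := s) (r := r) (z := z) hB
  have hmZ := abs_meanZ_le (v := v) (s := s) (r := r) (z := z) hB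
  rw [h1, hz] at h2
  rw [h1]
  -- `|v̄_r Γ_r| ≤ B Γ_r`, `|v̄_z ∮ω_r| ≤ B K Γ_r`
  have e1 : -(meanR v r z s * vortCirc v r z s) ≤ B * vortCirc v r z s := by
    have := neg_abs_le (meanR v r z s)
    nlinarith [abs_nonneg (meanR v r z s)]
  have e2 : meanZ v r z s * radVortCirc v r z s ≤ B * (K * vortCirc v r z s) := by
    have h3 : meanZ v r z s * radVortCirc v r z s ≤ |meanZ v r z s| * |radVortCirc v r z s| := by
      rw [← abs_mul]; exact le_abs_self _
    exact h3.trans (mul_le_mul hmZ hrad (abs_nonneg _) ((abs_nonneg _).trans hmZ))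
  nlinarith [e1, e2, heddy, h2]

/-- **The axis-circulation data (H1)–(H5) of AxisTwistDoor's Harnack chain for a class profile satisfying the EDDY HYPOTHESIS**
(the re-run of `…ShellBound.stub_shellSupersolution` with the cone replaced): constants `δ₀` (Lei–Ren's shell width),
`C_d := (B + 2max(C,0))(1+K+K')`, `A := 2π max(C,0)`, `Γ* := Γ*(I₀)`. -/
theorem axisCirculationData_of_eddy (hS : ShellFact) {K K' C : ℝ} {I₀ : ℝ≥0∞} (hK : 0 ≤ K) (hK' : 0 ≤ K') (hI₀ : I₀ < ⊤) :
    ∃ δ₀ Cd A Γstar : ℝ, 0 < δ₀ ∧ 0 ≤ Cd ∧ 0 ≤ A ∧ 0 ≤ Γstar ∧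
      ∀ (w : ℝ → EuclideanSpace ℝ (Fin 3) → EuclideanSpace ℝ (Fin 3)) (ϖ : ℝ → EuclideanSpace ℝ (Fin 3) → ℝ)
        (G : ℝ → EuclideanSpace ℝ (Fin 3) → EuclideanSpace ℝ (Fin 3) →L[ℝ] EuclideanSpace ℝ (Fin 3)),
        InClass C w ϖ G → typeIBound (Iio (0 : ℝ) ×ˢ univ) w ϖ G ≤ I₀ → SignE3 w →
        (∀ s : ℝ, s < 0 → ∀ r : ℝ, 0 < r → ∀ z : ℝ,
          |radVortCirc w r z s| ≤ K * vortCirc w r z s ∧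
            ∀ B : ℝ, (∀ θ : ℝ, ‖w s (cylPt r θ z)‖ ≤ B) → remainder w r z s ≤ K' * B * vortCirc w r z s) →
        AxisCirculationData (circ w) δ₀ Cd A Γstar := by
  obtain ⟨δ₀, B, hδ₀, hB, hshell⟩ := hS I₀ hI₀
  obtain ⟨Γstar, hΓ0, hΓ⟩ := circ_le_of_shellFact hS hI₀
  have hC0 : 0 ≤ max C 0 := le_max_right _ _
  refine ⟨δ₀, (B + 2 * max C 0) * (1 + K + K'), 2 * Real.pi * max C 0, Γstar, hδ₀, by positivity, by positivity, hΓ0,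
    fun w ϖ G hcl hI hsign hE => ?_⟩
  have h1 : ∀ s : ℝ, s < 0 → ContDiff ℝ 1 (w s) := fun s hs =>
    (contDiff_slice hcl hs).of_le (by exact_mod_cast le_top)
  have hcse : CircleSwirlEquation w :=
    AveragedConeLiouville.CircleSwirl.stub_circleSwirl C w ϖ G hcl.decay hcl.cont hcl.mild hcl.divFree hcl.suitable
      hcl.weakGrad hcl.typeI
  refine ⟨(AxisTwistDoorAveragedConeLiouvilleCircleToolkit.stub_circleToolkit C w ϖ G hcl).1, ?_, ?_, ?_, ?_⟩
  · intro s hs z r₁ r₂ h0 h12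
    exact ⟨circ_nonneg w (h1 s hs) hsign hs h0 z, circ_mono w (h1 s hs) hsign hs h0 h12 z⟩
  · intro s r z hs1 hs hr hr1 hz
    have hs1' : (-(16 / 9) : ℝ) < s := by norm_num at hs1; linarith
    exact hΓ C w ϖ G hcl hI hsign s hs1' hs r hr.le (by linarith) z (by linarith)
  · intro s hs r hr z
    rcases hr.eq_or_lt with h | h
    · rw [← h, AveragedConeLiouville.CircMonotone.circ_zero, mul_zero, zero_div]
    · calc circ w r z s ≤ 2 * Real.pi * C * (r / Real.sqrt (-s)) := circ_le_typeI hcl.decay hs h z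
        _ ≤ 2 * Real.pi * max C 0 * (r / Real.sqrt (-s)) := by
            gcongr
            exact le_max_left _ _
        _ = 2 * Real.pi * max C 0 * r / Real.sqrt (-s) := by ring
  · obtain ⟨a, δ, ha1, ha2, hδ1, hδ2, hw⟩ := hshell C w ϖ G hcl hI
    refine ⟨a, δ, ha1, ha2, hδ1, hδ2, fun s r z hs1 hs hr hra hz hreg => ?_⟩
    have haδ : 1 / 2 < a - δ := by linarith
    have hB₁ : ∀ θ : ℝ, ‖w s (cylPt r θ z)‖ ≤ B + 2 * max C 0 := fun θ =>
      norm_le_on_shell_or_early hB haδ (fun t ht1 ht2 r' θ' z' h1' h2' h3' => (hw t ht1 ht2 r' θ' z' h1' h2' h3').1)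
        hcl.decay hs1 hs hra hz hreg θ
    obtain ⟨hrad, hrem⟩ := hE s hs r hr z
    exact gamma34_of_eddy hcl hsign hcse hs hr hrad (hrem _ hB₁) hB₁

/-! ### The one-scale contraction and flux decay under the eddy hypothesis -/

/-- **The one-scale contraction under the eddy hypothesis** (AxisTwistDoor's `unitContraction_of`, re-run): for `K, K' ≥ 0`, `C`,
`I₀ < ∞`, `κ₀ > 0` there are `σ ∈ (0,1]`, `Γ*` such that every class profile with these constants, the sign, the eddy hypothesis
and the non-decay level `κ₀` has `Γ ≤ Γ*` on `𝒬(9/10)` and the contraction «`Γ ≤ M` on `𝒬(9/10)` ⇒ `Γ ≤ (1−σ)M` on `𝒬(9/20)`». -/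
theorem unitContraction_of_eddy (hS : ShellFact) (h5b : AxisHarnackChain) (hPos : PositivityPropagationFactC)
    {K K' C : ℝ} {I₀ : ℝ≥0∞} {κ₀ : ℝ} (hK : 0 ≤ K) (hK' : 0 ≤ K') (hI₀ : I₀ < ⊤) (hκ₀ : 0 < κ₀) :
    ∃ σ Γstar : ℝ, 0 < σ ∧ σ ≤ 1 ∧
      ∀ (w : ℝ → EuclideanSpace ℝ (Fin 3) → EuclideanSpace ℝ (Fin 3)) (ϖ : ℝ → EuclideanSpace ℝ (Fin 3) → ℝ)
        (G : ℝ → EuclideanSpace ℝ (Fin 3) → EuclideanSpace ℝ (Fin 3) →L[ℝ] EuclideanSpace ℝ (Fin 3)),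
        InClass C w ϖ G → typeIBound (Iio (0 : ℝ) ×ˢ univ) w ϖ G ≤ I₀ → SignE3 w →
        (∀ s : ℝ, s < 0 → ∀ r : ℝ, 0 < r → ∀ z : ℝ,
          |radVortCirc w r z s| ≤ K * vortCirc w r z s ∧
            ∀ B : ℝ, (∀ θ : ℝ, ‖w s (cylPt r θ z)‖ ≤ B) → remainder w r z s ≤ K' * B * vortCirc w r z s) →
        (∀ ρ : ℝ, 0 < ρ → ∃ s r z : ℝ, -ρ ^ 2 < s ∧ s < 0 ∧ 0 < r ∧ r < ρ ∧ |z| < ρ ∧ κ₀ ≤ circ w r z s) →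
        CircBoundOn w (9 / 10) Γstar ∧
          ∀ M : ℝ, CircBoundOn w (9 / 10) M → CircBoundOn w (9 / 20) ((1 - σ) * M) := by
  obtain ⟨δ₀, Cd, A, Γstar, hδ₀, hCd, hA, hΓstar, hdata⟩ := axisCirculationData_of_eddy hS (C := C) hK hK' hI₀
  obtain ⟨c, hc, hchain⟩ := h5b hPos δ₀ Cd A κ₀ hδ₀ hCd hA hκ₀
  set L : ℝ := max Γstar κ₀ with hL
  have hLpos : 0 < L := lt_of_lt_of_le hκ₀ (le_max_right _ _)
  refine ⟨min 1 (c / L), Γstar, lt_min one_pos (div_pos hc hLpos), min_le_left _ _, ?_⟩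
  intro w ϖ G hcl hI hsign hE hlev
  have hD := hdata w ϖ G hcl hI hsign hE
  have hbound : CircBoundOn w (9 / 10) Γstar := by
    have h1 : CircBoundOn w 1 Γstar := fun s r z hs hs0 hr hr1 hz => hD.2.2.1 s r z hs hs0 hr hr1 hz
    exact circBoundOn_mono w (by norm_num) (by norm_num) h1
  refine ⟨hbound, fun M hM => ?_⟩
  set M' : ℝ := min M Γstar with hM'
  have hM'b : CircBoundOn w (9 / 10) M' := fun s r z hs hs0 hr hr1 hz =>
    le_min (hM s r z hs hs0 hr hr1 hz) (hbound s r z hs hs0 hr hr1 hz)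
  have hκM : κ₀ ≤ M' := by
    obtain ⟨s, r, z, hs, hs0, hr, hrρ, hz, hge⟩ := hlev (9 / 10) (by norm_num)
    exact hge.trans (hM'b s r z hs hs0 hr hrρ hz)
  have hM'L : M' ≤ L := (min_le_right _ _).trans (le_max_left _ _)
  have hch := hchain (circ w) Γstar M' hD hlev hM'b
  intro s r z hs hs0 hr hrρ hz
  have h1 : circ w r z s ≤ M' - c :=
    hch s r z (by nlinarith) hs0 hr (by linarith) (by linarith)
  have hσ : min 1 (c / L) * M' ≤ c := by
    have h2 : min 1 (c / L) * M' ≤ (c / L) * M' :=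
      mul_le_mul_of_nonneg_right (min_le_right _ _) (le_trans hκ₀.le hκM)
    have h3 : (c / L) * M' ≤ (c / L) * L := mul_le_mul_of_nonneg_left hM'L (div_nonneg hc.le hLpos.le)
    have h4 : (c / L) * L = c := div_mul_cancel₀ c hLpos.ne'
    linarith
  have hσ1 : min 1 (c / L) ≤ 1 := min_le_left _ _
  have hMM : M' ≤ M := min_le_left _ _
  have h5 : (1 - min 1 (c / L)) * M' ≤ (1 - min 1 (c / L)) * M :=
    mul_le_mul_of_nonneg_left hMM (by linarith)
  nlinarith

/-- **FLUX DECAY AT THE APEX UNDER THE EDDY HYPOTHESIS (energy class, UNCONDITIONAL).**  A profile of AxisTwistDoor's energy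
class (`InClass`: Type-I rate, continuity, Oseen–Duhamel identity, divergence-free slices, suitable weak with a weak gradient,
`𝐈 < ∞`) with the closed-hemisphere sign `ω₃ ≥ 0`, whose axis circles (all `r > 0`, `z`, `s < 0`) satisfy
(i) MEAN radial tilt dominated by the mean vertical vorticity, `|∮ω_r dl| ≤ K ∮ω₃ dl`, and
(ii) ONE-SIDED EDDY TORQUE slaved to the vertical-vorticity flux at the local velocity scale, `ℛ ≤ K'·B·∮ω₃ dl` whenever
`|v| ≤ B` on the circle,
has FLUX DECAY at the apex: `Γ(r,z,s) → 0` as the parabolic cylinder `𝒬(ρ)` shrinks (`FluxDecay v`).  This is the flux-decay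
half of AxisTwistDoor's `AveragedConeLiouville` (26889) with the circle-averaged cone REPLACED by the weaker dynamic hypothesis
(i)+(ii) (`eddyHyp_of_cone`); the regularity half (`RegularOfFluxDecay`) still needs the cone to control `ω_h` and is NOT
claimed here.  Inputs, all proved in the tree: `Shell.shellFact_holds`, `PositivityFactC.positivityPropagationFactC_holds`,
`HarnackChain.axisHarnackChain`, `fluxDecay_of_scale_contraction`. -/
theorem fluxDecay_of_eddy (C : ℝ) (v : ℝ → EuclideanSpace ℝ (Fin 3) → EuclideanSpace ℝ (Fin 3))
    (π : ℝ → EuclideanSpace ℝ (Fin 3) → ℝ)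
    (H : ℝ → EuclideanSpace ℝ (Fin 3) → EuclideanSpace ℝ (Fin 3) →L[ℝ] EuclideanSpace ℝ (Fin 3))
    (hcl : InClass C v π H) (hsign : SignE3 v) {K K' : ℝ} (hK : 0 ≤ K) (hK' : 0 ≤ K')
    (hE : ∀ s : ℝ, s < 0 → ∀ r : ℝ, 0 < r → ∀ z : ℝ,
      |radVortCirc v r z s| ≤ K * vortCirc v r z s ∧
        ∀ B : ℝ, (∀ θ : ℝ, ‖v s (cylPt r θ z)‖ ≤ B) → remainder v r z s ≤ K' * B * vortCirc v r z s) :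
    FluxDecay v := by
  have hShell : ShellFact := AveragedConeLiouville.Shell.shellFact_holds
  have hPos : PositivityPropagationFactC := AveragedConeLiouville.PositivityFactC.positivityPropagationFactC_holds
  have h5b : AxisHarnackChain := AveragedConeLiouville.HarnackChain.axisHarnackChain
  refine fluxDecay_of_scale_contraction v fun κ₀ hκ₀ hlev => ?_
  obtain ⟨σ, Γstar, hσ, hσ1, hunit⟩ :=
    unitContraction_of_eddy hShell h5b hPos (C := C) (I₀ := typeIBound (Iio (0 : ℝ) ×ˢ univ) v π H) hK hK' hcl.typeI hκ₀
  refine ⟨σ, Γstar, hσ, hσ1, (hunit v π H hcl le_rfl hsign hE hlev).1, fun ρ hρ hρ1 M hM => ?_⟩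
  have hcl' := inClass_nsRescale hcl hρ
  have hI' : typeIBound (Iio (0 : ℝ) ×ˢ univ) (nsRescale ρ v) (ρ ^ 2 • stPull (ρ ^ 2) ρ 0 0 π)
      (ρ ^ 2 • stPull (ρ ^ 2) ρ 0 0 H) ≤ typeIBound (Iio (0 : ℝ) ×ˢ univ) v π H :=
    (typeIBound_inClass_nsRescale hρ).le
  have h2 := (hunit (nsRescale ρ v) _ _ hcl' hI' (signE3_nsRescale hsign hρ) (eddyHyp_nsRescale hE hρ)
    (level_nsRescale hlev hρ)).2 M
  have hM' : CircBoundOn (nsRescale ρ v) (9 / 10) M := by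
    have e : ρ * (9 / 10) = 9 * ρ / 10 := by ring
    have h1 : CircBoundOn v (ρ * (9 / 10)) M := by rw [e]; exact hM
    exact circBoundOn_nsRescale hρ h1
  have h3 := circBoundOn_of_nsRescale hρ (h2 hM')
  have e : ρ * (9 / 20) = 9 * ρ / 20 := by ring
  rw [e] at h3
  exact h3

/-- **Corollary — the cone version recovered** (the flux-decay half of 26889, through the eddy hypothesis). -/
theorem fluxDecay_of_cone (C : ℝ) (v : ℝ → EuclideanSpace ℝ (Fin 3) → EuclideanSpace ℝ (Fin 3))
    (π : ℝ → EuclideanSpace ℝ (Fin 3) → ℝ)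
    (H : ℝ → EuclideanSpace ℝ (Fin 3) → EuclideanSpace ℝ (Fin 3) →L[ℝ] EuclideanSpace ℝ (Fin 3))
    (hcl : InClass C v π H) (hsign : SignE3 v) {K : ℝ} (hK : 0 ≤ K)
    (hcone : ∀ s : ℝ, s < 0 → ∀ r : ℝ, 0 < r → ∀ z : ℝ, tiltCirc v r z s ≤ K * vortCirc v r z s) : FluxDecay v :=
  fluxDecay_of_eddy C v π H hcl hsign hK (by positivity : (0:ℝ) ≤ 2 * (1 + K)) (eddyHyp_of_cone hcl hsign hcone)

end Summit.NavierStokesRegularity.NavierStokesRegularity.Theorems.HalfSpaceWindowDoorCirculationCarryingRigidityEddyTorqueFluxDecay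

end
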